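import Summits.QuantumFields.YangMills.Theorems.UniversalDetectorHankelWindow
import Summits.QuantumFields.YangMills.Theses.UniversalDetector
import HarnessLib

/-!
# Route `UniversalDetector`, LINE g10-1 «Hankel tightness» — the longitudinal Lipschitz modulus (support item)

Ideator seat ym-idea-8 (generation 10, lens «dual»).  This module PROVES the support item
`Summit.QuantumFields.YangMills.Theses.UniversalDetector.HankelLongitudinal` (stmt-QuantumFields-24001) of rung R2a
(`BalabanLadder.NT`): for every compact simple `G`, every lattice representation `r`, every unit map `a → 0⁺`,
far-boundedness of ALL rescaled plane–plane kernels `K⁶ = a⁻⁸ Cov_T(P_p(0), P_q(z))` (BDD) implies a Lipschitz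
modulus `|K⁶(z) − K⁶(z + n e_k)| ≤ Λ·(a n)` along every lattice axis segment that stays `η`-far from the origin and
`τ`-far from the hyperplane `{x_k = 0}` (`Λ = Λ(p, q, τ)`; thresholds `β ≥ β₅`, `a·L ≥ Λ₅`).

Mechanism (reflection positivity only — no cluster expansion, no continuum input): the unit time-step bound of
`UniversalDetectorHankelWindow` (log-convexity of the polarised mirror sequences, window half-width `⌊τ/(4a)⌋`),
transported to an arbitrary axis by hypercubic symmetry (`MirrorDomination.cov_coordPerm`, §13) and to negative
times by the reflection `cov_plane_zero_neg` (swapping `p ↔ q`), then telescoped along the segment (§14); the `a⁻⁸`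
normalisation turns the `O(a⁹/τ)` step into `O(a/τ)`.

HONEST FRAMING: no summit, rung or crux is proved; this closes a SUPPORT item of LINE g10-1 (the route's crux is
`SchemeEdgeLaws`).  Not Clay.  Refs: Fröhlich–Israel–Lieb–Simon (1978) Thm. 2.1; Osterwalder–Seiler (1978) §2;
Glimm–Jaffe (1987) §6.1 [folklore].
-/

set_option autoImplicit false

noncomputable section

open MeasureTheory Filter Topology
open Literature.MathematicalPhysics.QuantumFieldTheory Literature.MathematicalPhysics.QuantumLattice
  Literature.Probability.LatticeModels
open Summit.QuantumFields.YangMills.Cruxes.OSLegsFromFemtoAndGap.DlrCollarTransfer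
open Summit.QuantumFields.YangMills.Cruxes.UniversalDetectorPlaneTight (cov_plane_zero_neg)
open Summit.QuantumFields.YangMills.Theorems.MirrorDomination (cov_coordPerm cov_eq_sub)
open Summit.QuantumFields.YangMills.Theorems.OSLegsFromFemtoAndGap (permPlane permPlane_valid)

namespace Summit.QuantumFields.YangMills.Cruxes.UniversalDetectorHankel

variable (G : Type) [Group G] [TopologicalSpace G] [IsTopologicalGroup G] [CompactSpace G]
  [MeasurableSpace G] [BorelSpace G] (r : LatticeRep G)

/-! ## §13 Reduction of an arbitrary axis to the time axis and of negative times to positive ones -/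

omit [Group G] [TopologicalSpace G] [IsTopologicalGroup G] [CompactSpace G] [MeasurableSpace G] [BorelSpace G] in
/-- The transposition `(0 k)` carries the unit vector `e_k` to `e₀`. -/
theorem single_apply_swap (k : Fin 4) (c : ℤ) (i : Fin 4) :
    (Pi.single k c : Site 4) (Equiv.swap 0 k i) = (Pi.single 0 c : Site 4) i := by
  by_cases hi0 : i = 0
  · subst hi0; rw [Equiv.swap_apply_left, Pi.single_eq_same, Pi.single_eq_same]
  · by_cases hik : i = k
    · subst hik; rw [Equiv.swap_apply_right, Pi.single_eq_of_ne (Ne.symm hi0), Pi.single_eq_of_ne hi0]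
    · rw [Equiv.swap_apply_of_ne_of_ne hi0 hik, Pi.single_eq_of_ne hik, Pi.single_eq_of_ne hi0]

/-- **Axis permutation.**  `Cov_T(P_p(0), P_q(w)) = Cov_T(P_{πp}(0), P_{πq}(w∘π))` for the transposition `π = (0 k)`
(hypercubic symmetry of the torus state; `MirrorDomination.cov_coordPerm`). [folklore] -/
theorem cov_plane_swap (β : ℝ) (L : ℕ) (k : Fin 4) (p q : Fin 4 × Fin 4) (w w' : Site 4)
    (hw' : ∀ i, w' i = w (Equiv.swap 0 k i)) :
    torusE G r β L (fun U => plane G r p 0 U * plane G r q w U) -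
        torusE G r β L (plane G r p 0) * torusE G r β L (plane G r q w) =
      torusE G r β L (fun U => plane G r (permPlane (Equiv.swap 0 k) p) 0 U *
          plane G r (permPlane (Equiv.swap 0 k) q) w' U) -
        torusE G r β L (plane G r (permPlane (Equiv.swap 0 k) p) 0) *
          torusE G r β L (plane G r (permPlane (Equiv.swap 0 k) q) w') := by
  have h := cov_coordPerm G r β L (Equiv.swap 0 k) p q 0 w
  rw [cov_eq_sub, cov_eq_sub, Equiv.symm_swap] at h
  have h0 : (fun i => (0 : Site 4) (Equiv.swap 0 k i)) = 0 := rfl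
  have h1 : (fun i => w (Equiv.swap 0 k i)) = w' := funext fun i => (hw' i).symm
  rw [h0, h1] at h
  exact h.symm

/-- **Unit time-step of the plane two-point function at an axially separated site**, both signs of the time
coordinate: for `w` in the box with `|a·w₀| ≥ τ` and far-box bounds `c_{pp}, c_{qq}, c_{pq}, c_{qp}` at physical
radius `τ/4`, `|Cov_T(P_p 0, P_q w) − Cov_T(P_p 0, P_q (w + e₀))| ≤ 12 (a/τ)(c_{pp} + c_{qq} + 2c_{pq} + 2c_{qp})`
(negative times are reflected to positive ones by `cov_plane_zero_neg`, swapping `p ↔ q`).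
[cite: GlimmJaffe1987, §6.1] -/
theorem abs_cov_sub_succ_le_of_far {β : ℝ} (hβ : 0 ≤ β) {L : ℕ} (hL : 1 ≤ L) {p q : Fin 4 × Fin 4}
    (hp : p.1 < p.2) (hq : q.1 < q.2) {a τ cpp cqq cpq cqp : ℝ} (ha : 0 < a) (haτ : a ≤ τ / 8) (ha1 : a ≤ 1)
    (haL : τ / 2 + 7 ≤ a * L)
    (hpp : ∀ z ∈ box 4 L, τ / 4 ≤ ‖a • siteToE z‖ →
      |torusE G r β L (fun U => plane G r p 0 U * plane G r p z U) -
          torusE G r β L (plane G r p 0) * torusE G r β L (plane G r p z)| ≤ cpp)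
    (hqq : ∀ z ∈ box 4 L, τ / 4 ≤ ‖a • siteToE z‖ →
      |torusE G r β L (fun U => plane G r q 0 U * plane G r q z U) -
          torusE G r β L (plane G r q 0) * torusE G r β L (plane G r q z)| ≤ cqq)
    (hpq : ∀ z ∈ box 4 L, τ / 4 ≤ ‖a • siteToE z‖ →
      |torusE G r β L (fun U => plane G r p 0 U * plane G r q z U) -
          torusE G r β L (plane G r p 0) * torusE G r β L (plane G r q z)| ≤ cpq)
    (hqp : ∀ z ∈ box 4 L, τ / 4 ≤ ‖a • siteToE z‖ →
      |torusE G r β L (fun U => plane G r q 0 U * plane G r p z U) -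
          torusE G r β L (plane G r q 0) * torusE G r β L (plane G r p z)| ≤ cqp)
    (w : Site 4) (hw : ∀ i, -(L : ℤ) ≤ w i ∧ w i ≤ L) (hτw : τ ≤ |a * (w 0 : ℝ)|) :
    |(torusE G r β L (fun U => plane G r p 0 U * plane G r q w U) -
          torusE G r β L (plane G r p 0) * torusE G r β L (plane G r q w)) -
        (torusE G r β L (fun U => plane G r p 0 U * plane G r q (w + Pi.single 0 1) U) -
          torusE G r β L (plane G r p 0) * torusE G r β L (plane G r q (w + Pi.single 0 1)))| ≤
      12 * (a / τ) * (cpp + cqq + 2 * cpq + 2 * cqp) := by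
  have hτ : 0 < τ := by linarith
  have hwmem : w ∈ box 4 L := by simp only [box, Fintype.mem_piFinset, Finset.mem_Icc]; exact hw
  have haw : τ ≤ a * |(w 0 : ℝ)| := by rwa [abs_mul, abs_of_pos ha] at hτw
  have hwfar : τ / 4 ≤ ‖a • siteToE w‖ := le_norm_smul_siteToE_of_le_time ha.le w (by linarith)
  have hcpq : 0 ≤ cpq := (abs_nonneg _).trans (hpq w hwmem hwfar)
  have hcqp : 0 ≤ cqp := (abs_nonneg _).trans (hqp w hwmem hwfar)
  have h12 : 0 ≤ 12 * (a / τ) := by positivity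
  obtain ⟨t, hwt⟩ : ∃ t : ℤ, w 0 = t := ⟨_, rfl⟩
  rw [hwt] at haw
  have ht0 : t ≠ 0 := by
    intro h0; rw [h0] at haw; simp only [Int.cast_zero, abs_zero, mul_zero] at haw; linarith
  -- the spatial offset
  set y : Site 4 := w - Pi.single 0 t with hydef
  have hy0 : y 0 = 0 := by simp [hydef, hwt]
  have hyi : ∀ i, i ≠ 0 → y i = w i := fun i hi => by simp [hydef, Pi.single_eq_of_ne hi]
  have hyL : ∀ i, -(L : ℤ) ≤ y i ∧ y i ≤ L := by
    intro i
    by_cases hi : i = 0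
    · subst hi; rw [hy0]; constructor <;> omega
    · rw [hyi i hi]; exact hw i
  have hw_eq : w = y + Pi.single 0 t := by simp [hydef]
  have hw'_eq : w + (Pi.single 0 1 : Site 4) = y + Pi.single 0 (t + 1) := by
    rw [Pi.single_add, ← add_assoc, ← hw_eq]
  rcases lt_or_gt_of_ne ht0 with hneg | hpos
  · -- negative time: reflect through `cov_plane_zero_neg`
    have e1 := cov_plane_zero_neg r β L p q (-w)
    rw [neg_neg] at e1
    have e2 := cov_plane_zero_neg r β L p q (-(w + (Pi.single 0 1 : Site 4)))
    rw [neg_neg] at e2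
    have hn1 : -w = -y + Pi.single 0 (-t - 1 + 1) := by
      rw [sub_add_cancel, Pi.single_neg, ← neg_add, ← hw_eq]
    have hn2 : -(w + (Pi.single 0 1 : Site 4)) = -y + Pi.single 0 (-t - 1) := by
      rw [hw'_eq, neg_add, ← Pi.single_neg]; congr 2; ring
    have hyL' : ∀ i, -(L : ℤ) ≤ (-y) i ∧ (-y) i ≤ L := fun i => by
      simp only [Pi.neg_apply]; have := hyL i; constructor <;> omega
    have ht1 : τ / a - 1 ≤ ((-t - 1 : ℤ) : ℝ) := by
      have hneg' : ((t : ℤ) : ℝ) < 0 := by exact_mod_cast hneg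
      rw [abs_of_neg hneg'] at haw
      have : τ / a ≤ -((t : ℤ) : ℝ) := by rw [div_le_iff₀ ha]; linarith
      push_cast; linarith
    have ht2 : -t - 1 ≤ (L : ℤ) := by have := (hw 0).1; omega
    have key := abs_crossCov_succ_sub_le_of_far G r hβ hL hq hp (y := -y) (by simp [hy0]) hyL' ha haτ ha1 haL
      hqq hpp hqp ht1 ht2
    unfold crossCov at key
    rw [e1, e2, hn1, hn2]
    refine key.trans ?_
    nlinarith [hcpq]
  · -- positive time
    have ht1 : τ / a - 1 ≤ ((t : ℤ) : ℝ) := by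
      have hpos' : (0 : ℝ) < ((t : ℤ) : ℝ) := by exact_mod_cast hpos
      rw [abs_of_pos hpos'] at haw
      have : τ / a ≤ ((t : ℤ) : ℝ) := by rw [div_le_iff₀ ha]; linarith
      linarith
    have ht2 : t ≤ (L : ℤ) := hwt ▸ (hw 0).2
    have key := abs_crossCov_succ_sub_le_of_far G r hβ hL hp hq hy0 hyL ha haτ ha1 haL hpp hqq hpq ht1 ht2
    unfold crossCov at key
    rw [abs_sub_comm] at key
    rw [hw'_eq, hw_eq]
    refine key.trans ?_
    nlinarith [hcqp]

/-- **Unit step along an arbitrary axis `k` at an axially separated site** (`|a·w_k| ≥ τ`): the time-axis bound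
`abs_cov_sub_succ_le_of_far` transported by the transposition `(0 k)` (`cov_plane_swap`); the far-box bounds are
those of the PERMUTED plane pairs. [cite: GlimmJaffe1987, §6.1] -/
theorem abs_cov_sub_succ_axis_le_of_far {β : ℝ} (hβ : 0 ≤ β) {L : ℕ} (hL : 1 ≤ L) {p q : Fin 4 × Fin 4}
    (hp : p.1 < p.2) (hq : q.1 < q.2) (k : Fin 4) {a τ cpp cqq cpq cqp : ℝ} (ha : 0 < a) (haτ : a ≤ τ / 8)
    (ha1 : a ≤ 1) (haL : τ / 2 + 7 ≤ a * L)
    (hpp : ∀ z ∈ box 4 L, τ / 4 ≤ ‖a • siteToE z‖ →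
      |torusE G r β L (fun U => plane G r (permPlane (Equiv.swap 0 k) p) 0 U *
            plane G r (permPlane (Equiv.swap 0 k) p) z U) -
          torusE G r β L (plane G r (permPlane (Equiv.swap 0 k) p) 0) *
            torusE G r β L (plane G r (permPlane (Equiv.swap 0 k) p) z)| ≤ cpp)
    (hqq : ∀ z ∈ box 4 L, τ / 4 ≤ ‖a • siteToE z‖ →
      |torusE G r β L (fun U => plane G r (permPlane (Equiv.swap 0 k) q) 0 U *
            plane G r (permPlane (Equiv.swap 0 k) q) z U) -
          torusE G r β L (plane G r (permPlane (Equiv.swap 0 k) q) 0) *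
            torusE G r β L (plane G r (permPlane (Equiv.swap 0 k) q) z)| ≤ cqq)
    (hpq : ∀ z ∈ box 4 L, τ / 4 ≤ ‖a • siteToE z‖ →
      |torusE G r β L (fun U => plane G r (permPlane (Equiv.swap 0 k) p) 0 U *
            plane G r (permPlane (Equiv.swap 0 k) q) z U) -
          torusE G r β L (plane G r (permPlane (Equiv.swap 0 k) p) 0) *
            torusE G r β L (plane G r (permPlane (Equiv.swap 0 k) q) z)| ≤ cpq)
    (hqp : ∀ z ∈ box 4 L, τ / 4 ≤ ‖a • siteToE z‖ →
      |torusE G r β L (fun U => plane G r (permPlane (Equiv.swap 0 k) q) 0 U *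
            plane G r (permPlane (Equiv.swap 0 k) p) z U) -
          torusE G r β L (plane G r (permPlane (Equiv.swap 0 k) q) 0) *
            torusE G r β L (plane G r (permPlane (Equiv.swap 0 k) p) z)| ≤ cqp)
    (w : Site 4) (hw : ∀ i, -(L : ℤ) ≤ w i ∧ w i ≤ L) (hτw : τ ≤ |a * (w k : ℝ)|) :
    |(torusE G r β L (fun U => plane G r p 0 U * plane G r q w U) -
          torusE G r β L (plane G r p 0) * torusE G r β L (plane G r q w)) -
        (torusE G r β L (fun U => plane G r p 0 U * plane G r q (w + Pi.single k 1) U) -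
          torusE G r β L (plane G r p 0) * torusE G r β L (plane G r q (w + Pi.single k 1)))| ≤
      12 * (a / τ) * (cpp + cqq + 2 * cpq + 2 * cqp) := by
  obtain ⟨w', hw'⟩ : ∃ w' : Site 4, ∀ i, w' i = w (Equiv.swap 0 k i) := ⟨_, fun i => rfl⟩
  have hw'' : ∀ i, (w' + (Pi.single 0 1 : Site 4)) i = (w + (Pi.single k 1 : Site 4)) (Equiv.swap 0 k i) :=
    fun i => by rw [Pi.add_apply, hw' i, ← single_apply_swap k 1 i, Pi.add_apply]
  rw [cov_plane_swap G r β L k p q w w' hw', cov_plane_swap G r β L k p q _ (w' + (Pi.single 0 1 : Site 4)) hw'']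
  have hwi : ∀ i, -(L : ℤ) ≤ w' i ∧ w' i ≤ L := fun i => by rw [hw' i]; exact hw _
  have hτw' : τ ≤ |a * (w' 0 : ℝ)| := by rw [hw' 0, Equiv.swap_apply_left]; exact hτw
  exact abs_cov_sub_succ_le_of_far G r hβ hL (permPlane_valid _ hp) (permPlane_valid _ hq) ha haτ ha1 haL hpp hqq
    hpq hqp w' hwi hτw'

/-! ## §14 The route item -/
set_option maxHeartbeats 400000 in
/-- **LINE g10-1, support (ii): the longitudinal Lipschitz modulus `HankelLongitudinal` holds** — for every compact
simple `G`, every lattice representation and every unit map `a → 0⁺`: far-bounded rescaled plane kernels (BDD at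
all valid plane pairs) have increments `≤ Λ·(a n)` along lattice axis segments that stay `η`-far from the origin and
`τ`-far from the transverse hyperplane.  Proof: hypercubic symmetry moves the axis to time, reflection moves negative
times to positive ones, and along the time axis the polarised mirror forms `Cov_T(W∘Θ₀, τ_n W)`,
`W = P_p(0) + P_q(y)`, and the two diagonal mirror sequences are non-negative and LOG-CONVEX by reflection positivity,
hence have slopes `O(sup/k)` at distance `k ≍ τ/a` from the ends of a far window on which BDD bounds them by
`O(a⁸)` — so each unit step costs `O(a⁹/τ)`, i.e. `O(a/τ)` after the `a⁻⁸` normalisation.  No summit, rung or crux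
is proved: this closes the support item `UniversalDetector.HankelLongitudinal` (stmt-QuantumFields-24001) only.
[cite: FrohlichIsraelLiebSimon1978, Thm. 2.1; OsterwalderSeiler1978, §2; GlimmJaffe1987, §6.1] -/
theorem universalDetector_hankelLongitudinal :
    Summit.QuantumFields.YangMills.Theses.UniversalDetector.HankelLongitudinal := by
  intro G _ _ _ _
  letI : MeasurableSpace G := borel G
  haveI : BorelSpace G := ⟨rfl⟩
  intro r a ha hlim ker6 hB p q hp hq η hη τ hτ
  simp only [ker6] at hB ⊢
  choose! C β₅ Λ₅ hBDD using hB
  obtain ⟨βa, hβa⟩ : ∃ βa : ℝ, ∀ β, βa ≤ β → a β ≤ min (τ / 8) 1 := by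
    have hpos : (0 : ℝ) < min (τ / 8) 1 := lt_min (by linarith) one_pos
    exact Filter.eventually_atTop.1 (hlim.eventually (Iic_mem_nhds hpos))
  set η₄ : ℝ := τ / 4 with hη₄
  have hη₄pos : 0 < η₄ := by positivity
  set P : Fin 4 → Fin 4 × Fin 4 := fun k => permPlane (Equiv.swap 0 k) p with hP
  set Q : Fin 4 → Fin 4 × Fin 4 := fun k => permPlane (Equiv.swap 0 k) q with hQ
  have hPv : ∀ k, (P k).1 < (P k).2 := fun k => permPlane_valid _ hp
  have hQv : ∀ k, (Q k).1 < (Q k).2 := fun k => permPlane_valid _ hq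
  set Cs : Fin 4 → ℝ := fun k =>
    |C (P k) (P k) η₄| + |C (Q k) (Q k) η₄| + 2 * |C (P k) (Q k) η₄| + 2 * |C (Q k) (P k) η₄| with hCs
  set Bs : Fin 4 → ℝ := fun k =>
    |β₅ (P k) (P k) η₄| + |β₅ (Q k) (Q k) η₄| + |β₅ (P k) (Q k) η₄| + |β₅ (Q k) (P k) η₄| with hBs
  set Ls : Fin 4 → ℝ := fun k =>
    |Λ₅ (P k) (P k) η₄| + |Λ₅ (Q k) (Q k) η₄| + |Λ₅ (P k) (Q k) η₄| + |Λ₅ (Q k) (P k) η₄| with hLs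
  have hCs0 : ∀ k, 0 ≤ Cs k := fun k => by positivity
  have hBs0 : ∀ k, 0 ≤ Bs k := fun k => by positivity
  have hLs0 : ∀ k, 0 ≤ Ls k := fun k => by positivity
  refine ⟨12 / τ * ∑ k, Cs k, |βa| + ∑ k, Bs k, τ / 2 + 7 + ∑ k, Ls k, ?_⟩
  intro β hβ L hL k z n hseg
  have haβ := ha β
  have hBsum : Bs k ≤ ∑ k', Bs k' := Finset.single_le_sum (fun i _ => hBs0 i) (Finset.mem_univ k)
  have hLsum : Ls k ≤ ∑ k', Ls k' := Finset.single_le_sum (fun i _ => hLs0 i) (Finset.mem_univ k)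
  have hCsum : Cs k ≤ ∑ k', Cs k' := Finset.single_le_sum (fun i _ => hCs0 i) (Finset.mem_univ k)
  have hBall : 0 ≤ ∑ k', Bs k' := Finset.sum_nonneg fun i _ => hBs0 i
  have hLall : 0 ≤ ∑ k', Ls k' := Finset.sum_nonneg fun i _ => hLs0 i
  have hCall : 0 ≤ ∑ k', Cs k' := Finset.sum_nonneg fun i _ => hCs0 i
  have hβa' : βa ≤ β := by linarith [le_abs_self βa]
  obtain ⟨haτ8, ha1⟩ := le_min_iff.1 (hβa β hβa')
  have hβ0 : 0 ≤ β := by linarith [abs_nonneg βa]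
  have haL : τ / 2 + 7 ≤ a β * L := by linarith
  have hL1 : 1 ≤ L := by
    rcases Nat.eq_zero_or_pos L with h0 | hpos
    · subst h0; simp only [Nat.cast_zero, mul_zero] at haL; linarith
    · exact hpos
  -- far-box bounds in covariance letters
  have far : ∀ p' q' : Fin 4 × Fin 4, p'.1 < p'.2 → q'.1 < q'.2 → β₅ p' q' η₄ ≤ β → Λ₅ p' q' η₄ ≤ a β * L →
      ∀ w ∈ box 4 L, τ / 4 ≤ ‖a β • siteToE w‖ →
        |torusE G r β L (fun U => plane G r p' 0 U * plane G r q' w U) -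
            torusE G r β L (plane G r p' 0) * torusE G r β L (plane G r q' w)| ≤ (a β) ^ 8 * |C p' q' η₄| := by
    intro p' q' hp' hq' hβ' hL' w hw hfar
    have h := hBDD p' q' hp' hq' η₄ hη₄pos β hβ' L hL' w hw hfar
    rw [abs_mul, abs_of_pos (pow_pos (inv_pos.2 haβ) 8), inv_pow, ← div_eq_inv_mul,
      div_le_iff₀ (pow_pos haβ 8)] at h
    nlinarith [le_abs_self (C p' q' η₄), pow_pos haβ 8]
  -- thresholds of the four pairs at axis `k`
  have thr : ∀ x b l : ℝ, |b| ≤ Bs k → |l| ≤ Ls k → b ≤ β ∧ l ≤ a β * L := fun x b l hb hl =>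
    ⟨by linarith [le_abs_self b, abs_nonneg βa], by linarith [le_abs_self l]⟩
  have aPP := abs_nonneg (β₅ (P k) (P k) η₄); have aQQ := abs_nonneg (β₅ (Q k) (Q k) η₄)
  have aPQ := abs_nonneg (β₅ (P k) (Q k) η₄); have aQP := abs_nonneg (β₅ (Q k) (P k) η₄)
  have lPP := abs_nonneg (Λ₅ (P k) (P k) η₄); have lQQ := abs_nonneg (Λ₅ (Q k) (Q k) η₄)
  have lPQ := abs_nonneg (Λ₅ (P k) (Q k) η₄); have lQP := abs_nonneg (Λ₅ (Q k) (P k) η₄)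
  have tPP := thr 0 (β₅ (P k) (P k) η₄) (Λ₅ (P k) (P k) η₄) (by simp only [hBs]; linarith)
    (by simp only [hLs]; linarith)
  have tQQ := thr 0 (β₅ (Q k) (Q k) η₄) (Λ₅ (Q k) (Q k) η₄) (by simp only [hBs]; linarith)
    (by simp only [hLs]; linarith)
  have tPQ := thr 0 (β₅ (P k) (Q k) η₄) (Λ₅ (P k) (Q k) η₄) (by simp only [hBs]; linarith)
    (by simp only [hLs]; linarith)
  have tQP := thr 0 (β₅ (Q k) (P k) η₄) (Λ₅ (Q k) (P k) η₄) (by simp only [hBs]; linarith)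
    (by simp only [hLs]; linarith)
  -- telescoping along the segment, by induction on `n`; the unit step is `abs_cov_sub_succ_axis_le_of_far`
  induction n with
  | zero => simp
  | succ m ih =>
      have ih' := ih fun j hj => hseg j (by omega)
      obtain ⟨hw1, -, hw3⟩ := hseg m (by omega)
      simp only [box, Fintype.mem_piFinset, Finset.mem_Icc] at hw1
      have e : z + (Pi.single k (((m + 1 : ℕ)) : ℤ) : Site 4) = z + Pi.single k (m : ℤ) + Pi.single k 1 := by
        rw [Nat.cast_succ, Pi.single_add, add_assoc]
      rw [e]
      have key := abs_cov_sub_succ_axis_le_of_far G r hβ0 hL1 hp hq k haβ haτ8 ha1 haL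
        (far (P k) (P k) (hPv k) (hPv k) tPP.1 tPP.2) (far (Q k) (Q k) (hQv k) (hQv k) tQQ.1 tQQ.2)
        (far (P k) (Q k) (hPv k) (hQv k) tPQ.1 tPQ.2) (far (Q k) (P k) (hQv k) (hPv k) tQP.1 tQP.2)
        (z + Pi.single k (m : ℤ)) hw1 (by rw [Pi.add_apply, Pi.single_eq_same]; push_cast; exact hw3)
      have key' := key.trans_eq (show 12 * (a β / τ) * ((a β) ^ 8 * |C (P k) (P k) η₄| +
          (a β) ^ 8 * |C (Q k) (Q k) η₄| + 2 * ((a β) ^ 8 * |C (P k) (Q k) η₄|) + 2 * ((a β) ^ 8 * |C (Q k) (P k) η₄|)) =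
            12 / τ * Cs k * a β * (a β) ^ 8 by simp only [hCs]; ring)
      have h1 : 12 / τ * Cs k ≤ 12 / τ * ∑ k', Cs k' := mul_le_mul_of_nonneg_left hCsum (by positivity)
      have h2 : 0 ≤ a β * (a β) ^ 8 := by positivity
      have step : |(a β)⁻¹ ^ 8 * (torusE G r β L (fun U => plane G r p 0 U * plane G r q (z + Pi.single k (m : ℤ)) U) -
            torusE G r β L (plane G r p 0) * torusE G r β L (plane G r q (z + Pi.single k (m : ℤ)))) -
          (a β)⁻¹ ^ 8 * (torusE G r β L (fun U => plane G r p 0 U *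
              plane G r q (z + Pi.single k (m : ℤ) + Pi.single k 1) U) -
            torusE G r β L (plane G r p 0) *
              torusE G r β L (plane G r q (z + Pi.single k (m : ℤ) + Pi.single k 1)))| ≤
          12 / τ * (∑ k', Cs k') * a β := by
        rw [← mul_sub, abs_mul, abs_of_pos (pow_pos (inv_pos.2 haβ) 8), inv_pow, ← div_eq_inv_mul,
          div_le_iff₀ (pow_pos haβ 8)]
        refine key'.trans ?_
        nlinarith
      have comb := (abs_sub_le _ _ _).trans (add_le_add ih' step)
      refine comb.trans (le_of_eq ?_)
      push_cast
      ring

end Summit.QuantumFields.YangMills.Cruxes.UniversalDetectorHankel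

end
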